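import Summits.BirchSwinnertonDyer.BirchSwinnertonDyer.Theorems.AlignedTransportAtTwoMainConjectureOfRankZeroBSDAtTwoFineRoadRealKummerWitnessPrimary
import HarnessLib

/-!
# Values at the complex conjugation of the equivariant Kummer classes of Γ-stable unit families: classes of `H¹(H, E[2])` with
# value `T_{min}` and `T_{max}` (the families `eᵢ − q`, `q ∈ ℚ`) — toolkit for the `E[2]`-level archimedean index FOUR

Cell `bsd-f1-sign2`, WIDTH-5 attach seat `bsd-line-att-p5` (gen 9) on line `birth` of crux C2 stmt-BirchSwinnertonDyer-22298
`MainConjectureOfRankZeroBSDAtTwo` (route `AlignedTransportAtTwo`); successor task (i) named by att-p5 g8 (HOME HANDOFF «-line-att-p5 g8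
FINAL»: «generalise the construction to any Γ-equivariant unit family … image of res_w at the E[2] level is ALL of Hom(D_w, E[2])»).
A `--supports 22298 --as helper` file. HONEST FRAMING: THEOREMS ONLY — no definition, no named fact, no `sorry`; C2-NEUTRAL (the
verdict «blocked-on GreenbergMuConjectureIrreducible» is untouched); BSD is NOT proved by any of this.

WHAT. att-p5 g8 (`…FineRoadRealKummerWitness`) built ONE class of `H¹(H, E[2])` with non-zero restriction at a real place where
`E[2]` is rational (`Δ_E > 0` over `ℚ`): the equivariant Kummer class of the units `αᵢ = (eᵢ − eᵢ₊₁)(eᵢ − eᵢ₊₂)`, whose value at the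
complex conjugation `c_w` is the MIDDLE letter. Here the construction is run for an ARBITRARY Γ-stable unit family
`a : Fin 3 → K̄ˣ` (`g aᵢ = a_{π_g i}`), with an explicit VALUE FORMULA `f(τ) = Σ_{ι aᵢ < 0} Tᵢ` at every complex conjugation `τ`, and
instantiated on the families `eᵢ − q`, `q ∈ ℚ`: a rational `q` just above the least real abscissa gives the value `T_{min}`, one just
below the largest gives `Σ_{i ≠ max} Tᵢ = T_{max}`. With the middle letter of g8 all three non-zero values occur; the sibling
`…FineRoadRealKummerIndex` turns this into «`res_w : H¹(H, E[2]) → Hom(D_w, E[2]) = E[2]` is ONTO, `infKer H E[2] w` has index 4».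

* §1 `eq_zero_iff_evalH1_eq_zero` — for `G = {1, c}` acting trivially, a class of `H¹(G, M) = Hom(G, M)` is zero iff its value at `c`
  is (tree `H1TrivialAction.evalH1`).
* §2 **`exists_equivariant_cocycle_of_units`** (any field of characteristic `0`, any elliptic `E`, any `H ≤ Γ_K`): the continuous
  homomorphism `f = Σᵢ ψᵢ ∘ χ_{aᵢ} : H ⊓ ker ρ̄_{E,2} → E[2]` is `H`-equivariant and `f(τ) = Σ_{ι aᵢ < 0} Tᵢ` at every complex
  conjugation `τ`; **`exists_class_apply_eq_of_units`** — the descended class `y ∈ H¹(H, E[2])` (att-p3 g4 `PerfectDescentSurj`):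
  EVERY cocycle of `y` takes that value at `τ`.
* §3 `T_add_T_eq_T` (the third letter), `sum_ite_eq_T`, `exists_rat_cuts` (rational cuts of three distinct reals), `smul_xT_sub_ratCast`
  (`g (eᵢ − q) = e_{π_g i} − q`), **`exists_classes_apply_eq_T_min_max`** — classes `y₁, y₃ ∈ H¹(H, E[2])` with values `T_{i₁}`,
  `T_{i₃}` at `τ`, `i₁`/`i₃` the index of the least/largest real abscissa `ι eᵢ`.

References: J.-P. Serre, *Local Fields* X §3; *Galois Cohomology* I §2.3, §2.6; J. H. Silverman, *AEC* III.6.4(b), VIII.1, X.1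
(Prop. 1.4: the Kummer pairing `E(K)/2E(K) × Γ_K → E[2]` via `√(x − eᵢ)`); J. S. Milne, *ADT* I §4 p. 55; R. Greenberg, LNM 1716 (1999)
§4 pp. 106–107; crux workfile `RELAXED-COEFFICIENTS-att-p5.md` §7 (cell bsd-f1-sign2).
-/

set_option autoImplicit false
-- the Theorems namespace of this sub repeats the summit name by design (D-0017 nested layout)
set_option linter.dupNamespace false

noncomputable section

open scoped Classical

namespace Summit.BirchSwinnertonDyer.BirchSwinnertonDyer.Theorems.AlignedTransportAtTwoFineRoad.RealKummerValues

open WeierstrassCurve NumberField Field Literature.NumberTheory.EllipticCurves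
  Literature.NumberTheory.EllipticCurves.GreenbergSelmer Literature.NumberTheory.GaloisRepresentations
  Literature.NumberTheory.EllipticCurves.DokchitserDokchitser2012
  Summit.BirchSwinnertonDyer.BirchSwinnertonDyer.Theorems.AlignedTransportAtTwoFineRoad
  Summit.BirchSwinnertonDyer.BirchSwinnertonDyer.Theorems.AlignedTransportAtTwoFineRoad.RealKummerWitnessPrelim

/-! ## §1 `H¹` of a group of order `≤ 2` acting trivially: a class is its value at the non-trivial element -/

section OrderTwo

variable {G : Type} [Group G] [TopologicalSpace G] [IsTopologicalGroup G] {M : Type} [AddCommGroup M]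
  [DistribMulAction G M] [TopologicalSpace M] [DiscreteTopology M]

/-- For a group `G = {1, c}` of order `≤ 2` acting trivially on `M`, a class of `H¹(G, M) = Hom(G, M)` vanishes iff its value at `c`
vanishes. [cite: SerreGaloisCohomology1997, I §2.3 (H¹ of a trivial module is Hom)] -/
theorem eq_zero_iff_evalH1_eq_zero [Finite G] (htriv : ∀ (g : G) (m : M), g • m = m) (hG : Nat.card G ≤ 2) {c : G}
    (hc : c ≠ 1) (η : discreteH1 G M) : η = 0 ↔ evalH1 htriv c η = 0 := by
  refine ⟨fun h ↦ by rw [h, map_zero], fun h ↦ ?_⟩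
  apply ext_of_trivial htriv
  intro g
  have h0 : ∀ g : G, (cocycleOf G M htriv 0).1 g = 0 := fun g ↦ by
    rw [← oneCocycleClass_zero, cocycleOf_oneCocycleClass]; rfl
  rw [h0]
  by_cases hg : g = 1
  · rw [hg, contOneCocycles.apply_one]
  · rw [eq_of_ne_one_of_natCard_le_two hG hg hc]
    exact h

end OrderTwo

/-! ## §2 The equivariant Kummer homomorphism of a Γ-stable unit family and the values of its descended class -/

section Units

variable {K : Type} [Field K] [CharZero K] (W : WeierstrassCurve K) [W.IsElliptic]

/-- **The `H`-equivariant Kummer homomorphism of a Γ-STABLE unit family.** Let `a : Fin 3 → K̄` be non-zero with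
`g • a i = a (π_g i)` for every `g ∈ Γ_K` (`π_g` the permutation of the letters `Tᵢ`; instances: `aᵢ = αᵢ = (eᵢ − eᵢ₊₁)(eᵢ − eᵢ₊₂)`
of att-p5 g8, and `aᵢ = eᵢ − q`, `q ∈ ℚ`, below). On `H′ = H ⊓ ker ρ̄_{E,2}` (which fixes every `a i`) the three Kummer sign
characters `χ_{aᵢ}` give the continuous homomorphism `f = Σᵢ ψᵢ ∘ χ_{aᵢ} : H′ → E[2]` (`ψᵢ(±1) = 0, Tᵢ`), which is
`H`-EQUIVARIANT (`f(g x g⁻¹) = g f(x)`, conjugation formula `χ_a(g x g⁻¹) = χ_{g⁻¹a}(x)`), and at EVERY complex conjugation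
`τ ∈ H′` (embedding `ι`) its value is `f(τ) = Σ_{ι aᵢ < 0} Tᵢ` (`χ_{a}(τ) = −1 ⟺ ι a < 0`; the `ι aᵢ` are real).
[cite: SerreLocalFields1979, X §3] [cite: SilvermanAEC2009, X.1 (Prop. 1.4, the Kummer pairing via x − eᵢ)] -/
theorem exists_equivariant_cocycle_of_units (hK2 : (2 : K) ≠ 0) (H : Subgroup (absoluteGaloisGroup K))
    (a : Fin 3 → AlgebraicClosure K) (ha0 : ∀ i, a i ≠ 0)
    (hsmul : ∀ (g : absoluteGaloisGroup K) (i : Fin 3), g • a i = a (permGal W hK2 g i)) :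
    ∃ z : contOneCocycles (discreteTopRep ↥(H ⊓ (W.galoisRepTorsion 2).ker) ↥(W.geomTorsion 2)),
      (∀ g ∈ H, ∀ x y : ↥(H ⊓ (W.galoisRepTorsion 2).ker),
          (y : absoluteGaloisGroup K) = g * x * g⁻¹ → z.1 y = g • z.1 x) ∧
        ∀ (τ : absoluteGaloisGroup K) (hτ : τ ∈ H ⊓ (W.galoisRepTorsion 2).ker) (ι : AlgebraicClosure K →+* ℂ),
          (∀ x : AlgebraicClosure K, ι (τ • x) = starRingEnd ℂ (ι x)) →
            z.1 ⟨τ, hτ⟩ = ∑ i : Fin 3, if 0 < (ι (a i)).re then 0 else T W hK2 i := by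
  have hfixa : ∀ i, ∀ n ∈ H ⊓ (W.galoisRepTorsion 2).ker, n • a i = a i := fun i n hn ↦ by
    rw [hsmul, permGal_eq_one_of_mem_ker W hK2 hn.2, Equiv.Perm.one_apply]
  have htriv : ∀ (n : ↥(H ⊓ (W.galoisRepTorsion 2).ker)) (m : ↥(W.geomTorsion 2)), n • m = m := fun n m ↦
    PerfectDescent.smul_eq_self_of_mem_ker_galoisRepTorsion_two W n.2.2 m
  have h2tor : ∀ m : ↥(W.geomTorsion 2), m + m = 0 := add_self_eq_zero_geomTorsion_two W
  -- the three Kummer sign characters and the homomorphism `f`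
  set χ : Fin 3 → (↥(H ⊓ (W.galoisRepTorsion 2).ker) →* Multiplicative (ZMod 2)) :=
    fun i ↦ kummerSign (a i) (ha0 i) (H ⊓ (W.galoisRepTorsion 2).ker) (hfixa i) with hχ
  set f : ↥(H ⊓ (W.galoisRepTorsion 2).ker) → ↥(W.geomTorsion 2) :=
    fun x ↦ ∑ i : Fin 3, if Multiplicative.toAdd (χ i x) = 0 then 0 else T W hK2 i with hf
  have hfmul : ∀ x y, f (x * y) = f x + f y := by
    intro x y
    simp only [hf, map_mul, toAdd_mul, ← Finset.sum_add_distrib]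
    exact Finset.sum_congr rfl fun i _ ↦ ite_add_eq_add_ite _ (h2tor _) _ _
  have hfcont : Continuous f :=
    continuous_finsetSum _ fun i _ ↦
      (continuous_of_discreteTopology (f := fun c : Multiplicative (ZMod 2) ↦
          if Multiplicative.toAdd c = 0 then (0 : ↥(W.geomTorsion 2)) else T W hK2 i)).comp
        (continuous_kummerSign _ _ _ _)
  refine ⟨homCocycle htriv f hfmul hfcont, ?_, ?_⟩
  · -- `H`-equivariance: `f(g x g⁻¹) = g • f(x)`
    intro g hg x y hy
    rw [homCocycle_apply, homCocycle_apply]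
    have hconj : ∀ i, χ i y = χ (permGal W hK2 g⁻¹ i) x := fun i ↦
      kummerSign_conj_eq (ha0 i) (ha0 _) _ (hfixa i) (hfixa _) g (hsmul g⁻¹ i) x y hy
    simp only [hf, hconj, Finset.smul_sum, smul_ite, smul_zero]
    symm
    refine Fintype.sum_equiv (permGal W hK2 g) _ _ fun j ↦ ?_
    have hππ : permGal W hK2 g⁻¹ (permGal W hK2 g j) = j := by
      rw [← Equiv.Perm.mul_apply, ← permGal_mul, inv_mul_cancel, permGal_one, Equiv.Perm.one_apply]
    rw [hππ, T_permGal]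
  · -- the value at a complex conjugation `τ`
    intro τ hτ ι hι
    rw [homCocycle_apply]
    have hsign : ∀ i, Multiplicative.toAdd (χ i ⟨τ, hτ⟩) = 0 ↔ 0 < (ι (a i)).re := fun i ↦
      toAdd_kummerSign_eq_zero_iff_re_pos (a i) (ha0 i) _ (hfixa i) ⟨τ, hτ⟩ ι hι
    simp only [hf, hsign]

/-- **Descent with values.** Under the hypotheses of `exists_equivariant_cocycle_of_units` there is a class `y ∈ H¹(H, E[2])` (att-p3
g4's perfect descent `PerfectDescentSurj.exists_resOfLe_eq_geomTorsion_two`) EVERY cocycle `ζ` of which takes at EVERY complex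
conjugation `τ ∈ H ⊓ ker ρ̄_{E,2}` (embedding `ι`) the value `ζ(τ) = Σ_{ι aᵢ < 0} Tᵢ` (a cocycle of `y` restricts on `H ⊓ ker ρ̄` to
THE homomorphism `f` — one cocycle per class under a trivial action — and two cocycles of `y` differ by `g ↦ g b − b`, zero at
`τ`). [cite: SerreGaloisCohomology1997, I §2.6 (b)] [cite: SerreLocalFields1979, X §3] -/
theorem exists_class_apply_eq_of_units (hK2 : (2 : K) ≠ 0) (H : Subgroup (absoluteGaloisGroup K))
    (a : Fin 3 → AlgebraicClosure K) (ha0 : ∀ i, a i ≠ 0)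
    (hsmul : ∀ (g : absoluteGaloisGroup K) (i : Fin 3), g • a i = a (permGal W hK2 g i)) :
    ∃ y : subgroupH1 H ↥(W.geomTorsion 2), ∀ ζ : contOneCocycles (discreteTopRep ↥H ↥(W.geomTorsion 2)),
      oneCocycleClass _ ζ = y →
        ∀ (τ : absoluteGaloisGroup K) (hτ : τ ∈ H ⊓ (W.galoisRepTorsion 2).ker) (ι : AlgebraicClosure K →+* ℂ),
          (∀ x : AlgebraicClosure K, ι (τ • x) = starRingEnd ℂ (ι x)) →
            ζ.1 ⟨τ, hτ.1⟩ = ∑ i : Fin 3, if 0 < (ι (a i)).re then 0 else T W hK2 i := by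
  obtain ⟨z, hzeq, hzval⟩ := exists_equivariant_cocycle_of_units W hK2 H a ha0 hsmul
  obtain ⟨y, hy⟩ := PerfectDescent.exists_resOfLe_eq_geomTorsion_two W hK2 H z hzeq
  have htriv : ∀ (n : ↥(H ⊓ (W.galoisRepTorsion 2).ker)) (m : ↥(W.geomTorsion 2)), n • m = m := fun n m ↦
    PerfectDescent.smul_eq_self_of_mem_ker_galoisRepTorsion_two W n.2.2 m
  refine ⟨y, fun ζ hζ τ hτ ι hι ↦ ?_⟩
  -- the restriction of `ζ` to `H ⊓ ker ρ̄` IS `z`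
  have hres : resOfLe (↥(W.geomTorsion 2)) (inf_le_left : H ⊓ (W.galoisRepTorsion 2).ker ≤ H) (oneCocycleClass _ ζ) =
      oneCocycleClass _ (contOneCocycles.pullback (subgroupInclusion (inf_le_left : H ⊓ (W.galoisRepTorsion 2).ker ≤ H))
        (resHomOfEquivariant (subgroupInclusion (inf_le_left : H ⊓ (W.galoisRepTorsion 2).ker ≤ H))
          (AddMonoidHom.id _) (fun _ _ ↦ rfl)) ζ) :=
    map_oneCocycleClass _ _ _ ζ
  rw [hζ, hy, eq_comm, oneCocycleClass_eq_iff_of_trivial htriv] at hres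
  have hζτ : ζ.1 ⟨τ, hτ.1⟩ = z.1 ⟨τ, hτ⟩ := by
    rw [← hres, contOneCocycles.pullback_apply]
    rfl
  rw [hζτ, hzval τ hτ ι hι]

end Units

/-! ## §3 Three letters, three reals, and the unit families `eᵢ − q` (`q ∈ ℚ`): classes with value `T_{min}` and `T_{max}` -/

section Letters

variable {K : Type} [Field K] (W : WeierstrassCurve K) [W.IsElliptic] (h2 : (2 : K) ≠ 0)

/-- The third letter: `T_a + T_b = T_c` for `{a, b, c} = {0, 1, 2}` (`E[2] = {O, T₀, T₁, T₂}`, `T_a + T_b ∉ {O, T_a, T_b}`).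
[cite: SilvermanAEC2009, Cor. III.6.4(b) (E[m] ≅ ℤ/mℤ × ℤ/mℤ)] -/
theorem T_add_T_eq_T {a b c : Fin 3} (hab : a ≠ b) (hca : c ≠ a) (hcb : c ≠ b) : T W h2 a + T W h2 b = T W h2 c := by
  have h2tor := add_self_eq_zero_geomTorsion_two W
  rcases eq_zero_or_eq_T W h2 (T W h2 a + T W h2 b) with h | ⟨j, hj⟩
  · exact absurd h (T_add_T_ne_zero W h2 hab)
  · have hja : j ≠ a := by
      rintro rfl
      exact ThetaPartnerXRoute.T_ne_zero' h2 W b (by simpa using hj)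
    have hjb : j ≠ b := by
      rintro rfl
      have : T W h2 a = 0 := by
        have e : T W h2 a + T W h2 j - T W h2 j = 0 := by rw [hj, sub_self]
        simpa using e
      exact ThetaPartnerXRoute.T_ne_zero' h2 W a this
    have hfin : ∀ a b c j : Fin 3, a ≠ b → c ≠ a → c ≠ b → j ≠ a → j ≠ b → j = c := by decide
    rw [hj, hfin a b c j hab hca hcb hja hjb]

/-- `Σᵢ [i ≠ j] Tᵢ = T_j`: the two letters other than `T_j` add up to `T_j`. [cite: SilvermanAEC2009, Cor. III.6.4(b) (E[m] ≅ ℤ/mℤ × ℤ/mℤ)] -/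
theorem sum_ite_eq_T (j : Fin 3) : (∑ i : Fin 3, if i = j then (0 : ↥(W.geomTorsion 2)) else T W h2 i) = T W h2 j := by
  fin_cases j
  · simp only [Fin.sum_univ_three, Fin.zero_eta, Fin.isValue, ↓reduceIte, one_ne_zero, zero_add,
      show (2 : Fin 3) ≠ 0 by decide]
    exact T_add_T_eq_T W h2 (by decide) (by decide) (by decide)
  · simp only [Fin.sum_univ_three, Fin.mk_one, Fin.isValue, zero_ne_one, ↓reduceIte, add_zero,
      show (2 : Fin 3) ≠ 1 by decide]
    exact T_add_T_eq_T W h2 (by decide) (by decide) (by decide)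
  · simp only [Fin.sum_univ_three, Fin.reduceFinMk, Fin.isValue, ↓reduceIte, add_zero, show (0 : Fin 3) ≠ 2 by decide,
      show (1 : Fin 3) ≠ 2 by decide]
    exact T_add_T_eq_T W h2 (by decide) (by decide) (by decide)

end Letters

/-- **Rational cuts of three distinct reals**: there are indices `i₁ ≠ i₃` (the least and the largest value) and rationals `q, q'`
avoiding the three values with `{i : rᵢ < q} = {i₁}` and `{i : q' < rᵢ} = {i₃}`. [folklore] -/
theorem exists_rat_cuts (r : Fin 3 → ℝ) (hr : Function.Injective r) :
    ∃ i₁ i₃ : Fin 3, i₁ ≠ i₃ ∧ (∀ i, r i₁ ≤ r i) ∧ (∀ i, r i ≤ r i₃) ∧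
      (∃ q : ℚ, ∀ i, (r i < q ↔ i = i₁) ∧ r i ≠ q) ∧ (∃ q : ℚ, ∀ i, ((q : ℝ) < r i ↔ i = i₃) ∧ r i ≠ q) := by
  obtain ⟨i₁, h₁⟩ := Finite.exists_min r
  obtain ⟨i₃, h₃⟩ := Finite.exists_max r
  have hcases : ∀ j i : Fin 3, i = j ∨ i = j + 1 ∨ i = j + 2 := by decide
  have hs1 : ∀ j : Fin 3, j + 1 ≠ j := by decide
  have hs2 : ∀ j : Fin 3, j + 2 ≠ j := by decide
  have hlt : ∀ {i j : Fin 3}, i ≠ j → r i ≤ r j → r i < r j := fun hij hle ↦ lt_of_le_of_ne hle (hr.ne hij)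
  refine ⟨i₁, i₃, ?_, h₁, h₃, ?_, ?_⟩
  · rintro rfl
    have hc : ∀ i, r i = r i₁ := fun i ↦ le_antisymm (h₃ i) (h₁ i)
    exact hs1 i₁ (hr (hc (i₁ + 1)))
  · -- `q` strictly between the least value and the other two
    have ha : r i₁ < min (r (i₁ + 1)) (r (i₁ + 2)) :=
      lt_min (hlt (hs1 i₁).symm (h₁ _)) (hlt (hs2 i₁).symm (h₁ _))
    obtain ⟨q, hq1, hq2⟩ := exists_rat_btwn ha
    refine ⟨q, fun i ↦ ?_⟩
    rcases hcases i₁ i with rfl | rfl | rfl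
    · exact ⟨⟨fun _ ↦ rfl, fun _ ↦ hq1⟩, hq1.ne⟩
    · have h := lt_of_lt_of_le hq2 (min_le_left _ _)
      exact ⟨⟨fun h' ↦ absurd (h.trans h') (lt_irrefl _), fun h' ↦ absurd h' (hs1 i₁)⟩, h.ne'⟩
    · have h := lt_of_lt_of_le hq2 (min_le_right _ _)
      exact ⟨⟨fun h' ↦ absurd (h.trans h') (lt_irrefl _), fun h' ↦ absurd h' (hs2 i₁)⟩, h.ne'⟩
  · -- `q'` strictly between the other two and the largest value
    have ha : max (r (i₃ + 1)) (r (i₃ + 2)) < r i₃ :=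
      max_lt (hlt (hs1 i₃) (h₃ _)) (hlt (hs2 i₃) (h₃ _))
    obtain ⟨q, hq1, hq2⟩ := exists_rat_btwn ha
    refine ⟨q, fun i ↦ ?_⟩
    rcases hcases i₃ i with rfl | rfl | rfl
    · exact ⟨⟨fun _ ↦ rfl, fun _ ↦ hq2⟩, hq2.ne'⟩
    · have h := lt_of_le_of_lt (le_max_left _ _) hq1
      exact ⟨⟨fun h' ↦ absurd (h.trans h') (lt_irrefl _), fun h' ↦ absurd h' (hs1 i₃)⟩, h.ne⟩
    · have h := lt_of_le_of_lt (le_max_right _ _) hq1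
      exact ⟨⟨fun h' ↦ absurd (h.trans h') (lt_irrefl _), fun h' ↦ absurd h' (hs2 i₃)⟩, h.ne⟩

section RationalUnits

variable {K : Type} [Field K] [CharZero K] (W : WeierstrassCurve K) [W.IsElliptic]

omit [CharZero K] in
/-- `Γ_K` fixes the rationals of `K̄`. [folklore] -/
theorem smul_ratCast (g : absoluteGaloisGroup K) (q : ℚ) : g • ((q : ℚ) : AlgebraicClosure K) = q := by
  rw [absoluteGaloisGroup.smul_def, map_ratCast]

omit [CharZero K] in
/-- **The unit family `eᵢ − q` (`q ∈ ℚ`) is Γ-stable**: `g (eᵢ − q) = e_{π_g i} − q` (`g eᵢ = e_{π_g i}`, tree `smul_xT`).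
[cite: SilvermanAEC2009, VIII.§1 (G_{K̄/K} acts on E(K̄) coordinatewise)] -/
theorem smul_xT_sub_ratCast (hK2 : (2 : K) ≠ 0) (g : absoluteGaloisGroup K) (q : ℚ) (i : Fin 3) :
    g • (xT W hK2 i - (q : AlgebraicClosure K)) = xT W hK2 (permGal W hK2 g i) - (q : AlgebraicClosure K) := by
  rw [smul_sub, smul_xT, smul_ratCast]

/-- **Classes with value `T_{min}` and `T_{max}` at a complex conjugation.** For any field `K` of characteristic `0`, any elliptic
`E/K`, any `H ≤ Γ_K` and any `τ ∈ H ⊓ ker ρ̄_{E,2}` acting as complex conjugation under `ι : K̄ → ℂ`: the abscissae `ι eᵢ` are three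
distinct reals; with `i₁` (resp. `i₃`) the index of the LEAST (resp. LARGEST) one there are classes `y₁, y₃ ∈ H¹(H, E[2])` whose
cocycles take at `τ` the values `T_{i₁}` and `T_{i₃}` — the equivariant Kummer classes of the unit families `eᵢ − q` for a rational
`q` just above `ι e_{i₁}` (signs `(−, +, +)`) resp. just below `ι e_{i₃}` (signs `(−, −, +)`, value `Σ_{i ≠ i₃} Tᵢ = T_{i₃}`).
(att-p5 g8's family `αᵢ` gives the third value, the middle letter.) [cite: SilvermanAEC2009, X.1 (Prop. 1.4, the Kummer pairing via x − eᵢ)]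
[cite: SerreLocalFields1979, X §3] -/
theorem exists_classes_apply_eq_T_min_max (hK2 : (2 : K) ≠ 0) (H : Subgroup (absoluteGaloisGroup K))
    {τ : absoluteGaloisGroup K} (hτ : τ ∈ H ⊓ (W.galoisRepTorsion 2).ker)
    (ι : AlgebraicClosure K →+* ℂ) (hι : ∀ x : AlgebraicClosure K, ι (τ • x) = starRingEnd ℂ (ι x)) :
    ∃ i₁ i₃ : Fin 3, i₁ ≠ i₃ ∧ (∀ i, (ι (xT W hK2 i₁)).re ≤ (ι (xT W hK2 i)).re) ∧
      (∀ i, (ι (xT W hK2 i)).re ≤ (ι (xT W hK2 i₃)).re) ∧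
      (∃ y : subgroupH1 H ↥(W.geomTorsion 2), ∀ ζ : contOneCocycles (discreteTopRep ↥H ↥(W.geomTorsion 2)),
          oneCocycleClass _ ζ = y → ζ.1 ⟨τ, hτ.1⟩ = T W hK2 i₁) ∧
      (∃ y : subgroupH1 H ↥(W.geomTorsion 2), ∀ ζ : contOneCocycles (discreteTopRep ↥H ↥(W.geomTorsion 2)),
          oneCocycleClass _ ζ = y → ζ.1 ⟨τ, hτ.1⟩ = T W hK2 i₃) := by
  set e : Fin 3 → AlgebraicClosure K := xT W hK2 with he
  have hperm : permGal W hK2 τ = 1 := permGal_eq_one_of_mem_ker W hK2 hτ.2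
  have hreal : ∀ i, (ι (e i)).im = 0 := by
    intro i
    have h1 : τ • e i = e i := by rw [he, smul_xT, hperm, Equiv.Perm.one_apply]
    have h3 : starRingEnd ℂ (ι (e i)) = ι (e i) := by rw [← hι, h1]
    exact Complex.conj_eq_iff_im.mp h3
  set r : Fin 3 → ℝ := fun i ↦ (ι (e i)).re with hr
  have hιe : ∀ i, ι (e i) = ((r i : ℝ) : ℂ) := fun i ↦ Complex.ext (by simp [hr]) (by simp [hreal i])
  have hrinj : Function.Injective r := by
    intro i j hij
    apply xT_injective W hK2
    apply ι.injective
    rw [← he, hιe, hιe, hij]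
  -- the real parts of `ι (eᵢ − q)`
  have hre : ∀ (q : ℚ) (i : Fin 3), (ι (e i - (q : AlgebraicClosure K))).re = r i - q := by
    intro q i
    rw [map_sub, map_ratCast, Complex.sub_re, Complex.ratCast_re]
  have hne : ∀ (q : ℚ) (i : Fin 3), r i ≠ q → e i - (q : AlgebraicClosure K) ≠ 0 := by
    intro q i hq h0
    apply hq
    have := hre q i
    rw [h0, map_zero, Complex.zero_re] at this
    linarith
  obtain ⟨i₁, i₃, h13, hmin, hmax, ⟨q, hq⟩, ⟨q', hq'⟩⟩ := exists_rat_cuts r hrinj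
  refine ⟨i₁, i₃, h13, hmin, hmax, ?_, ?_⟩
  · obtain ⟨y, hy⟩ := exists_class_apply_eq_of_units W hK2 H (fun i ↦ e i - (q : AlgebraicClosure K))
      (fun i ↦ hne q i (hq i).2) (fun g i ↦ smul_xT_sub_ratCast W hK2 g q i)
    refine ⟨y, fun ζ hζ ↦ ?_⟩
    have hsum : (∑ i : Fin 3, if 0 < (ι (e i - (q : AlgebraicClosure K))).re then (0 : ↥(W.geomTorsion 2)) else T W hK2 i) =
        ∑ i : Fin 3, if i = i₁ then T W hK2 i else 0 := by
      refine Finset.sum_congr rfl fun i _ ↦ ?_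
      have hiff : 0 < (ι (e i - (q : AlgebraicClosure K))).re ↔ ¬ i = i₁ := by
        rw [hre, sub_pos, ← (hq i).1, not_lt]
        exact ⟨fun h ↦ h.le, fun h ↦ lt_of_le_of_ne h (fun h' ↦ (hq i).2 h'.symm)⟩
      by_cases hi : i = i₁
      · rw [if_neg (hiff.not.mpr (not_not.mpr hi)), if_pos hi]
      · rw [if_pos (hiff.mpr hi), if_neg hi]
    rw [hy ζ hζ τ hτ ι hι, hsum, Finset.sum_ite_eq', if_pos (Finset.mem_univ _)]
  · obtain ⟨y, hy⟩ := exists_class_apply_eq_of_units W hK2 H (fun i ↦ e i - (q' : AlgebraicClosure K))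
      (fun i ↦ hne q' i (hq' i).2) (fun g i ↦ smul_xT_sub_ratCast W hK2 g q' i)
    refine ⟨y, fun ζ hζ ↦ ?_⟩
    have hsum : (∑ i : Fin 3, if 0 < (ι (e i - (q' : AlgebraicClosure K))).re then (0 : ↥(W.geomTorsion 2)) else T W hK2 i) =
        ∑ i : Fin 3, if i = i₃ then 0 else T W hK2 i := by
      refine Finset.sum_congr rfl fun i _ ↦ ?_
      have hiff : 0 < (ι (e i - (q' : AlgebraicClosure K))).re ↔ i = i₃ := by
        rw [hre, sub_pos]
        exact (hq' i).1
      by_cases hi : i = i₃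
      · rw [if_pos (hiff.mpr hi), if_pos hi]
      · rw [if_neg (hiff.not.mpr hi), if_neg hi]
    rw [hy ζ hζ τ hτ ι hι, hsum, sum_ite_eq_T W hK2 i₃]

end RationalUnits

end Summit.BirchSwinnertonDyer.BirchSwinnertonDyer.Theorems.AlignedTransportAtTwoFineRoad.RealKummerValues

end
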